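import Summits.BirchSwinnertonDyer.BirchSwinnertonDyer.Theorems.GoldfeldAllTwistsTwoConverseTwinAdditiveTwoAdicPlusPFive
import Summits.BirchSwinnertonDyer.BirchSwinnertonDyer.Theorems.GoldfeldAllTwistsTwoConverseTwinAdditiveTwoPrimesTwistSelmer
import Summits.BirchSwinnertonDyer.BirchSwinnertonDyer.Theorems.GoldfeldAllTwistsTwoConverseTwinAdditiveSplitPrimeTwistSelmer
import HarnessLib

set_option linter.dupNamespace false -- namespace `…BirchSwinnertonDyer.BirchSwinnertonDyer…` is the cell's (D-0017 nested layout)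
set_option autoImplicit false

/-!
# OBJECT A7⁺, tranche T1, file D⁺-8: the SHARP Selmer set `S(−21qp, 112q²p²) ⊆ {1, 7}` of `A^{(−qp)} = 49a1^{(−qp)}` on a75+
# (`q ≡ 7 (8)`, `(q/7) = −1`; `p ≡ 5 (8)`, `(−7/p) = 1`, type α; `(p/q) = +1`) — the input of the `h2`-discharge on a75+ (FACT-FREE)

Cell `bsd-goldfeld`, seat `bsd-goldfeld-s1p-c3x` (gen 15); planner RULING (ccclxxxii) ORDER «OBJECT A7⁺ BY THE χ_Z CHANNEL», tranche T1
(memo `HOME/PLUS-CHIZ-CHANNEL.md` §2 D⁺). `--supports stmt-BirchSwinnertonDyer-20044` as a HELPER. Theses-free; theorems only; no definition,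
no fact binder, no `sorry`. FRONTIER-grade: a twist-density-ZERO sub-family; never distance-to-summit.

KILLS (seat's kill table `kills_a7x_plus.txt`, kit j322778 56/56 a75+ rows `A^{(−qp)}` ellrank 1/1/0): negatives at `ℝ`; the `q`-classes at `q`; `2, 14` at `p`
(`(2/p) = −1`, as X0 part a1); `p, 7p` AT `p` — the root `V′ = 224qT` resp. `32qT` of `V² − 42V + 448` is a non-zero SQUARE by D⁺-0′'s `p ≡ 5 (8)` key,
forcing `14q` resp. `2q` to be a square, against `(14q/p) = (2q/p) = −1`; `2p, 14p` AT `2` — two numeric `ℚ₂`-certificates `(105; 10, 280)`, `(105; 70, 40)`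
(keys mod `4` and mod `16`, `decide`) after `p ↦ 5`, `q ↦ −1`.
* §1 the numeric and class kills; §2 `twoIsogenySelmerGroup_oddTwoPrimesTwist_subset_pair_plusPFiveAlpha` (`S ⊆ {1, 7}`) and `card_… ≤ 2`.
HONEST FRAMING: a Selmer bound on a twist-density-ZERO cell; nothing about `L`-values; items 19140 / 19350 / 20044 unchanged; BSD is not proved by any of this.

References: [SilvermanAEC2009] Prop. X.4.9, Example X.4.10; [Serre1973] Ch. II §3.3 Thm 4; [CoatesLiTianZhai2015] §5 (type α).
-/

noncomputable section

open scoped Classical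

open WeierstrassCurve Literature.NumberTheory.EllipticCurves

namespace Summit.BirchSwinnertonDyer.BirchSwinnertonDyer.Theorems.GoldfeldGoodTwists

/-! ## §1 Local kills for `A^{(−qp)}` on a75+ -/

section LocalOddPFive
variable {q p : ℕ} [Fact q.Prime] [Fact p.Prime]

/-- A natural number not divisible by the prime `ℓ` is non-zero in `ZMod ℓ`, as an integer cast. [folklore] -/
private theorem intCast_ne_zero_of_not_dvd_oddPlusPFive {l : ℕ} [Fact l.Prime] {n : ℕ} (h : ¬ l ∣ n) : ((n : ℤ) : ZMod l) ≠ 0 := by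
  rw [Int.cast_natCast, Ne, ZMod.natCast_eq_zero_iff]; exact h

/-- A prime `ℓ ≠ 2, 7` divides no `2^a·7^b`. [folklore] -/
private theorem not_dvd_two_pow_mul_seven_pow_oddPlusPFive {l : ℕ} (hl : l.Prime) (hl2 : l ≠ 2) (hl7 : l ≠ 7) (a b : ℕ) :
    ¬ l ∣ 2 ^ a * 7 ^ b := by
  intro h
  rcases (Nat.Prime.dvd_mul hl).mp h with h | h
  · exact hl2 ((Nat.prime_dvd_prime_iff_eq hl Nat.prime_two).mp (hl.dvd_of_dvd_pow h))
  · exact hl7 ((Nat.prime_dvd_prime_iff_eq hl (by norm_num)).mp (hl.dvd_of_dvd_pow h))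

/-- `ℤ/4` / `ℤ/16` keys for `(105; 10, 280)` and `(105; 70, 40)`: shallow charts mod `4`, deep charts mod `16`. [folklore] -/
theorem keys_oddPlusPFive :
    (∀ T S : ZMod (2 ^ 2), S ^ 2 ≠ ((10 : ℤ) : ZMod (2 ^ 2)) + ((105 : ℤ) : ZMod (2 ^ 2)) * T ^ 2 + ((280 : ℤ) : ZMod (2 ^ 2)) * T ^ 4) ∧
    (∀ T S : ZMod (2 ^ 4), S ^ 2 ≠ ((280 : ℤ) : ZMod (2 ^ 4)) + ((105 : ℤ) : ZMod (2 ^ 4)) * T ^ 2 + ((10 : ℤ) : ZMod (2 ^ 4)) * T ^ 4) ∧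
    (∀ T S : ZMod (2 ^ 2), S ^ 2 ≠ ((70 : ℤ) : ZMod (2 ^ 2)) + ((105 : ℤ) : ZMod (2 ^ 2)) * T ^ 2 + ((40 : ℤ) : ZMod (2 ^ 2)) * T ^ 4) ∧
    (∀ T S : ZMod (2 ^ 4), S ^ 2 ≠ ((40 : ℤ) : ZMod (2 ^ 4)) + ((105 : ℤ) : ZMod (2 ^ 4)) * T ^ 2 + ((70 : ℤ) : ZMod (2 ^ 4)) * T ^ 4) := by
  refine ⟨?_, ?_, ?_, ?_⟩ <;> decide

/-- **`w² = 10u⁴ + 105u²z² + 280z⁴` has no non-trivial `ℚ₂`-point** (charts mod `4` / mod `16`). [cite: SilvermanAEC2009, Prop. X.4.9 and Example X.4.10] -/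
theorem not_isSoluble_two_numeric_ten_oddPlusPFive : ¬ ((twoIsogenyQuartic 105 10 280).map (Int.castRingHom ℚ_[2])).IsSoluble := by
  obtain ⟨k1, k2, -, -⟩ := keys_oddPlusPFive
  exact not_isSoluble_two_of_padicInt_charts (padicInt_two_sq_ne_of_zmodPow 2 k1) (padicInt_two_sq_ne_of_zmodPow 4 k2)

/-- **`w² = 70u⁴ + 105u²z² + 40z⁴` has no non-trivial `ℚ₂`-point** (charts mod `4` / mod `16`). [cite: SilvermanAEC2009, Prop. X.4.9 and Example X.4.10] -/
theorem not_isSoluble_two_numeric_seventy_oddPlusPFive : ¬ ((twoIsogenyQuartic 105 70 40).map (Int.castRingHom ℚ_[2])).IsSoluble := by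
  obtain ⟨-, -, k3, k4⟩ := keys_oddPlusPFive
  exact not_isSoluble_two_of_padicInt_charts (padicInt_two_sq_ne_of_zmodPow 2 k3) (padicInt_two_sq_ne_of_zmodPow 4 k4)

omit [Fact q.Prime] [Fact p.Prime] in
/-- **Class `2p ∈ S(−21qp, 112q²p²)` dies at `2`** (`q ≡ 7 (8)`, `p ≡ 5 (8)`): `p ↦ 5`, `q ↦ −1` give `(105; 10, 280)`.
[cite: SilvermanAEC2009, Prop. X.4.9 and Example X.4.10] [cite: Serre1973, Ch. II §3.3 Thm 4] -/
theorem not_isSoluble_two_class_twoP_oddPlusPFive (hq8 : q % 8 = 7) (hp8 : p % 8 = 5) {a d d' : ℤ} (ha : a = -21 * ((q : ℤ) * p))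
    (hd : d = (p : ℤ) * 2) (hd' : d' = (p : ℤ) * (56 * (q : ℤ) ^ 2)) : ¬ ((twoIsogenyQuartic a d d').map (Int.castRingHom ℚ_[2])).IsSoluble :=
  fun h ↦ by
  have h1 := isSoluble_two_of_common_factor (n := p) (n₀ := 5) (by omega) (a₀ := -21 * (q : ℤ)) (d₀ := 2) (e₀ := 56 * (q : ℤ) ^ 2)
    (by rw [ha]; ring) (by rw [hd]) (by rw [hd']) h
  have h2 := isSoluble_two_of_sq_factor (n := q) (n₀ := -1) (by omega) (a₁ := 5 * (-21)) (d := 5 * 2) (e₁ := 5 * 56)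
    (by ring) (by ring) h1
  norm_num at h2
  exact not_isSoluble_two_numeric_ten_oddPlusPFive h2

omit [Fact q.Prime] [Fact p.Prime] in
/-- **Class `14p ∈ S(−21qp, 112q²p²)` dies at `2`** (`q ≡ 7 (8)`, `p ≡ 5 (8)`): rescaled to `(105; 70, 40)`.
[cite: SilvermanAEC2009, Prop. X.4.9 and Example X.4.10] [cite: Serre1973, Ch. II §3.3 Thm 4] -/
theorem not_isSoluble_two_class_fourteenP_oddPlusPFive (hq8 : q % 8 = 7) (hp8 : p % 8 = 5) {a d d' : ℤ} (ha : a = -21 * ((q : ℤ) * p))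
    (hd : d = (p : ℤ) * 14) (hd' : d' = (p : ℤ) * (8 * (q : ℤ) ^ 2)) : ¬ ((twoIsogenyQuartic a d d').map (Int.castRingHom ℚ_[2])).IsSoluble :=
  fun h ↦ by
  have h1 := isSoluble_two_of_common_factor (n := p) (n₀ := 5) (by omega) (a₀ := -21 * (q : ℤ)) (d₀ := 14) (e₀ := 8 * (q : ℤ) ^ 2)
    (by rw [ha]; ring) (by rw [hd]) (by rw [hd']) h
  have h2 := isSoluble_two_of_sq_factor (n := q) (n₀ := -1) (by omega) (a₁ := 5 * (-21)) (d := 5 * 14) (e₁ := 5 * 8)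
    (by ring) (by ring) h1
  norm_num at h2
  exact not_isSoluble_two_numeric_seventy_oddPlusPFive h2

omit [Fact q.Prime] in
/-- **Class `p ∈ S(−21qp, 112q²p²)` dies at `p` on a75+**: a root `T` of `112q²T² − 21qT + 1` gives the non-zero SQUARE `V′ = 224qT` (D⁺-0′'s key),
so a square `T` would make `14q` a square. [cite: SilvermanAEC2009, Prop. X.4.9 and Example X.4.10] -/
theorem not_isSoluble_padic_class_p_oddPlusPFiveAlpha (hp8 : p % 8 = 5) (hp7 : legendreSym p (-7) = 1) (hα : ¬ ∃ x : ZMod p, x ^ 4 = -7)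
    (hns14q : ¬ IsSquare ((14 : ZMod p) * (q : ZMod p))) (h112q : ((112 * (q : ℤ) ^ 2 : ℤ) : ZMod p) ≠ 0)
    {d d' : ℤ} (hd : d = p * (1 : ℤ)) (hd' : d' = p * (112 * (q : ℤ) ^ 2)) :
    ¬ ((twoIsogenyQuartic (-21 * ((q : ℤ) * p)) d d').map (Int.castRingHom ℚ_[p])).IsSoluble := by
  refine not_isSoluble_padic_of_prime_dvd_coeffs_of_roots (p := p) (c := -21 * q) (e := 1) (e' := 112 * (q : ℤ) ^ 2) (by ring) hd hd'
    h112q (fun T hT ↦ ?_)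
  rintro ⟨X, rfl⟩
  push_cast at hT
  obtain ⟨⟨Y, hY⟩, hV0⟩ := isSquare_of_sq_sub_fortyTwo_mul_add_of_alpha_five hp8 hp7 hα (V := 224 * (q : ZMod p) * (X * X))
    (by linear_combination (448 : ZMod p) * hT)
  have hX0 : X ≠ 0 := by rintro rfl; apply hV0; ring
  apply hns14q
  refine ⟨Y / (4 * X), ?_⟩
  have h4X : (4 : ZMod p) * X ≠ 0 := by
    refine mul_ne_zero ?_ hX0
    intro h4; apply hV0
    linear_combination (56 * (q : ZMod p) * (X * X)) * h4
  rw [div_mul_div_comm, eq_div_iff (mul_ne_zero h4X h4X), ← hY]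
  ring

omit [Fact q.Prime] in
/-- **Class `7p ∈ S(−21qp, 112q²p²)` dies at `p` on a75+**: the root `V′ = 32qT` is a square, so a square `T` would make `2q` a square.
[cite: SilvermanAEC2009, Prop. X.4.9 and Example X.4.10] -/
theorem not_isSoluble_padic_class_sevenP_oddPlusPFiveAlpha (hp8 : p % 8 = 5) (hp7 : legendreSym p (-7) = 1) (hα : ¬ ∃ x : ZMod p, x ^ 4 = -7)
    (hns2q : ¬ IsSquare ((2 : ZMod p) * (q : ZMod p))) (h16q : ((16 * (q : ℤ) ^ 2 : ℤ) : ZMod p) ≠ 0)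
    {d d' : ℤ} (hd : d = p * (7 : ℤ)) (hd' : d' = p * (16 * (q : ℤ) ^ 2)) :
    ¬ ((twoIsogenyQuartic (-21 * ((q : ℤ) * p)) d d').map (Int.castRingHom ℚ_[p])).IsSoluble := by
  refine not_isSoluble_padic_of_prime_dvd_coeffs_of_roots (p := p) (c := -21 * q) (e := 7) (e' := 16 * (q : ℤ) ^ 2) (by ring) hd hd'
    h16q (fun T hT ↦ ?_)
  rintro ⟨X, rfl⟩
  push_cast at hT
  obtain ⟨⟨Y, hY⟩, hV0⟩ := isSquare_of_sq_sub_fortyTwo_mul_add_of_alpha_five hp8 hp7 hα (V := 32 * (q : ZMod p) * (X * X))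
    (by linear_combination (64 : ZMod p) * hT)
  have hX0 : X ≠ 0 := by rintro rfl; apply hV0; ring
  apply hns2q
  refine ⟨Y / (4 * X), ?_⟩
  have h4X : (4 : ZMod p) * X ≠ 0 := by
    refine mul_ne_zero ?_ hX0
    intro h4; apply hV0
    linear_combination (8 * (q : ZMod p) * (X * X)) * h4
  rw [div_mul_div_comm, eq_div_iff (mul_ne_zero h4X h4X), ← hY]
  ring

end LocalOddPFive

/-! ## §2 `S(−21qp, 112q²p²) ⊆ {1, 7}` on a75+ -/

section SelmerSOddPFive
variable {q p : ℕ} [Fact q.Prime] [Fact p.Prime]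

set_option maxHeartbeats 400000 in -- sixteen positive classes, each with its local computation (as F9a)
/-- **`S(−21qp, 112q²p²) ⊆ {1, 7}`** for `A^{(−qp)}` on a75+ (`q ≡ 7 (8)`, `(q/7) = −1`, `p ≡ 5 (8)`, `(−7/p) = 1`, type α, `(p/q) = +1`): negatives at `ℝ`,
the `q`-classes at `q`, `2, 14, p, 7p` at `p`, `2p, 14p` at `2`. [cite: SilvermanAEC2009, Prop. X.4.9 and Example X.4.10] -/
theorem twoIsogenySelmerGroup_oddTwoPrimesTwist_subset_pair_plusPFiveAlpha (hq8 : q % 8 = 7) (hq7 : jacobiSym q 7 = -1) (hp8 : p % 8 = 5)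
    (hp7 : legendreSym p (-7) = 1) (hα : ¬ ∃ x : ZMod p, x ^ 4 = -7) (hpq : jacobiSym p q = 1) :
    twoIsogenySelmerGroup (-21 * ((q : ℤ) * p)) (112 * ((q : ℤ) * p) ^ 2) ⊆ ({1, 7} : Finset ℤ) := by
  have hq : q.Prime := Fact.out
  have hp : p.Prime := Fact.out
  have hqZ : Prime (q : ℤ) := Nat.prime_iff_prime_int.mp hq
  have hpZ : Prime (p : ℤ) := Nat.prime_iff_prime_int.mp hp
  have hq0 : (q : ℤ) ≠ 0 := by exact_mod_cast hq.ne_zero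
  have hp0 : (p : ℤ) ≠ 0 := by exact_mod_cast hp.ne_zero
  have hq4 : q % 4 = 3 := by omega
  have hp4 : p % 4 = 1 := by omega
  have hq2 : q ≠ 2 := by rintro rfl; norm_num at hq4
  have hp2 : p ≠ 2 := by rintro rfl; norm_num at hp4
  have hqp : q ≠ p := by rintro rfl; omega
  have hq7' : q ≠ 7 := by
    rintro rfl; rw [jacobiSym.mod_left] at hq7; norm_num at hq7
  have hp7' : p ≠ 7 := by rintro rfl; norm_num at hp4
  obtain ⟨-, hm7q⟩ := legendreSym_seven_and_neg_seven_of_three_mod_four hq4 hq7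
  obtain ⟨h2p, h7p, -⟩ := legendreSym_two_seven_neg_one_of_five_mod_eight hp8 hp7
  -- `(q/p) = (p/q) = +1`
  have hqp_p : legendreSym p q = 1 := by
    have h := legendreSym.quadratic_reciprocity_one_mod_four hp4 hq2
    rw [← jacobiSym.legendreSym.to_jacobiSym] at hpq
    rw [← h]; exact hpq
  -- non-vanishing modulo `q` and `p`
  have hcq : ∀ a b : ℕ, (((2 ^ a * 7 ^ b : ℕ) : ℤ) : ZMod q) ≠ 0 := fun a b ↦
    intCast_ne_zero_of_not_dvd_oddPlusPFive (not_dvd_two_pow_mul_seven_pow_oddPlusPFive hq hq2 hq7' a b)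
  have hcp : ∀ a b : ℕ, (((2 ^ a * 7 ^ b : ℕ) : ℤ) : ZMod p) ≠ 0 := fun a b ↦
    intCast_ne_zero_of_not_dvd_oddPlusPFive (not_dvd_two_pow_mul_seven_pow_oddPlusPFive hp hp2 hp7' a b)
  have hpq0 : (p : ZMod q) ≠ 0 := by
    have := intCast_ne_zero_of_not_dvd_oddPlusPFive (l := q) (fun h ↦ hqp ((Nat.prime_dvd_prime_iff_eq hq hp).mp h)); exact_mod_cast this
  have hqp0 : ((q : ℤ) : ZMod p) ≠ 0 :=
    intCast_ne_zero_of_not_dvd_oddPlusPFive (l := p) (fun h ↦ hqp ((Nat.prime_dvd_prime_iff_eq hp hq).mp h).symm)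
  have hpqZ : (((p : ℤ) : ℤ) : ZMod q) ≠ 0 := by exact_mod_cast hpq0
  have hns_disc_q : ¬ IsSquare ((((-21 * p) ^ 2 - 4 * (112 * p ^ 2) : ℤ)) : ZMod q) := by
    rw [show ((-21 * p) ^ 2 - 4 * (112 * p ^ 2) : ℤ) = -7 * (p : ℤ) ^ 2 by ring]
    exact not_isSquare_mul_sq_zmod hpqZ ((legendreSym.eq_neg_one_iff q).mp hm7q)
  -- residues modulo `p`: `2`, `14`, `2q`, `14q` non-squares; non-vanishings
  have h4qp : ((4 * q : ℤ) : ZMod p) ≠ 0 := by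
    have h4 := hcp 2 0; norm_num at h4; push_cast; exact mul_ne_zero (by exact_mod_cast h4) (by exact_mod_cast hqp0)
  have h2qZ : ((2 * q : ℤ) : ZMod p) ≠ 0 := by
    have h2 := hcp 1 0; norm_num at h2; push_cast; exact mul_ne_zero (by exact_mod_cast h2) (by exact_mod_cast hqp0)
  have hns_2_p : ¬ IsSquare (((2 : ℤ)) : ZMod p) := (legendreSym.eq_neg_one_iff p).mp h2p
  have hns_14_p : ¬ IsSquare (((14 : ℤ)) : ZMod p) :=
    (legendreSym.eq_neg_one_iff p).mp (by rw [show (14 : ℤ) = 2 * 7 by norm_num, legendreSym.mul, h2p, h7p]; norm_num)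
  have hns_56qq_p : ¬ IsSquare (((56 * q ^ 2 : ℤ)) : ZMod p) := by
    rw [show (56 * q ^ 2 : ℤ) = 14 * (2 * q) ^ 2 by ring]; exact not_isSquare_mul_sq_zmod h2qZ hns_14_p
  have hns_8qq_p : ¬ IsSquare (((8 * q ^ 2 : ℤ)) : ZMod p) := by
    rw [show (8 * q ^ 2 : ℤ) = 2 * (2 * q) ^ 2 by ring]; exact not_isSquare_mul_sq_zmod h2qZ hns_2_p
  have hns14q : ¬ IsSquare ((14 : ZMod p) * (q : ZMod p)) := by
    have h := (legendreSym.eq_neg_one_iff p).mp (show legendreSym p (14 * q) = -1 by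
      rw [show (14 : ℤ) * q = 2 * 7 * q by ring, legendreSym.mul, legendreSym.mul, h2p, h7p, hqp_p]; norm_num)
    push_cast at h; exact h
  have hns2q : ¬ IsSquare ((2 : ZMod p) * (q : ZMod p)) := by
    have h := (legendreSym.eq_neg_one_iff p).mp (show legendreSym p (2 * q) = -1 by rw [legendreSym.mul, h2p, hqp_p]; norm_num)
    push_cast at h; exact h
  have h112q : ((112 * (q : ℤ) ^ 2 : ℤ) : ZMod p) ≠ 0 := by
    have h112 := hcp 4 1; norm_num at h112
    push_cast; exact mul_ne_zero (by exact_mod_cast h112) (pow_ne_zero 2 (by exact_mod_cast hqp0))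
  have h16q : ((16 * (q : ℤ) ^ 2 : ℤ) : ZMod p) ≠ 0 := by
    have h16 := hcp 4 0; norm_num at h16
    push_cast; exact mul_ne_zero (by exact_mod_cast h16) (pow_ne_zero 2 (by exact_mod_cast hqp0))
  have hb : (112 * ((q : ℤ) * p) ^ 2 : ℤ) ≠ 0 := by positivity
  intro d hd
  rw [mem_twoIsogenySelmerGroup_iff hb] at hd
  obtain ⟨hsqf, ⟨d', hdd'⟩, hloc⟩ := hd
  have hd'eq : (112 * ((q : ℤ) * p) ^ 2 : ℤ) / d = d' := by rw [hdd', Int.mul_ediv_cancel_left _ hsqf.ne_zero]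
  rw [hd'eq] at hloc
  obtain ⟨hreal, hpadic⟩ := hloc
  -- negatives die at `ℝ`
  have hdpos : 0 < d := by
    rcases lt_or_gt_of_ne hsqf.ne_zero with hneg | hpos
    · exfalso
      have hbpos : (0 : ℤ) < 112 * ((q : ℤ) * p) ^ 2 := by positivity
      have hd'neg : d' < 0 := by
        by_contra hcon
        nlinarith [mul_nonpos_iff.mpr (Or.inr ⟨hneg.le, le_of_not_gt hcon⟩)]
      have ha : (-21 * ((q : ℤ) * p)) ≤ 0 := by
        have : (0 : ℤ) ≤ (q : ℤ) * p := by positivity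
        linarith
      exact not_isSoluble_real_twoIsogenyQuartic_of_neg hneg hd'neg ha hreal
    · exact hpos
  -- the `q`-classes die at `q`
  have hqd : ¬ (q : ℤ) ∣ d := by
    rintro ⟨e, rfl⟩
    have h1 : e * d' = 112 * q * p ^ 2 := mul_left_cancel₀ hq0 (by linear_combination (-1 : ℤ) * hdd')
    have h3 : (q : ℤ) ∣ e * d' := ⟨112 * p ^ 2, by rw [h1]; ring⟩
    rcases hqZ.dvd_or_dvd h3 with h4 | h4
    · obtain ⟨e₁, rfl⟩ := h4
      exact hqZ.not_unit (hsqf (q : ℤ) ⟨e₁, by ring⟩)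
    · obtain ⟨e', rfl⟩ := h4
      have hm : e * e' = 112 * p ^ 2 := mul_left_cancel₀ hq0 (by linear_combination h1)
      exact not_isSoluble_padic_of_prime_dvd_coeffs (p := q) (c := -21 * p) (by ring) rfl rfl hm hns_disc_q (hpadic q)
  -- `d ∣ 14qp` prime to `q`: `d ∣ 14p`
  have h0 : d ∣ 112 * ((q : ℤ) * p) ^ 2 := ⟨d', hdd'⟩
  have h1 : d ∣ (14 * ((q : ℤ) * p)) ^ 4 := h0.trans ⟨343 * ((q : ℤ) * p) ^ 2, by ring⟩
  have h14qp : d ∣ 14 * ((q : ℤ) * p) := (hsqf.dvd_pow_iff_dvd (by norm_num)).mp h1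
  have hcopq : IsCoprime d (q : ℤ) := ((hqZ.irreducible.coprime_iff_not_dvd).mpr hqd).symm
  have h14p : d ∣ 14 * (p : ℤ) := by
    have : d ∣ (q : ℤ) * (14 * p) := by rw [show (q : ℤ) * (14 * p) = 14 * (q * p) by ring]; exact h14qp
    exact hcopq.dvd_of_dvd_mul_left this
  by_cases hpd : (p : ℤ) ∣ d
  · -- `d = p·e`, `e ∣ 14`: `p, 7p` die at `p`; `2p, 14p` at `2`
    exfalso
    obtain ⟨e, rfl⟩ := hpd
    have he14 : e ∣ 14 := by
      have : (p : ℤ) * e ∣ (p : ℤ) * 14 := by rw [mul_comm (p : ℤ) 14]; exact h14p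
      exact (mul_dvd_mul_iff_left hp0).mp this
    have hepos : 0 < e := pos_of_mul_pos_right hdpos (by positivity)
    have hele : e ≤ 14 := Int.le_of_dvd (by norm_num) he14
    have hd'e : e * d' = 112 * q ^ 2 * p := mul_left_cancel₀ hp0 (by linear_combination (-1 : ℤ) * hdd')
    interval_cases e <;> try omega
    · -- `d = p`: dies at `p` (D⁺-0′'s key, `14q` non-square)
      exact not_isSoluble_padic_class_p_oddPlusPFiveAlpha hp8 hp7 hα hns14q h112q rfl
        (show d' = (p : ℤ) * (112 * (q : ℤ) ^ 2) by linarith) (hpadic p)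
    · -- `d = 2p`: dies at `2`
      exact not_isSoluble_two_class_twoP_oddPlusPFive hq8 hp8 rfl rfl
        (show d' = (p : ℤ) * (56 * (q : ℤ) ^ 2) by linarith) (hpadic 2)
    · -- `d = 7p`: dies at `p` (`2q` non-square)
      exact not_isSoluble_padic_class_sevenP_oddPlusPFiveAlpha hp8 hp7 hα hns2q h16q rfl
        (show d' = (p : ℤ) * (16 * (q : ℤ) ^ 2) by linarith) (hpadic p)
    · -- `d = 14p`: dies at `2`
      exact not_isSoluble_two_class_fourteenP_oddPlusPFive hq8 hp8 rfl rfl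
        (show d' = (p : ℤ) * (8 * (q : ℤ) ^ 2) by linarith) (hpadic 2)
  · -- `d ∣ 14`, `d > 0`: `2, 14` die at `p` (`(2/p) = −1`)
    have hcopp : IsCoprime d (p : ℤ) := ((hpZ.irreducible.coprime_iff_not_dvd).mpr hpd).symm
    have hd14 : d ∣ 14 := hcopp.dvd_of_dvd_mul_right h14p
    have hle : d ≤ 14 := Int.le_of_dvd (by norm_num) hd14
    simp only [Finset.mem_insert, Finset.mem_singleton]
    interval_cases d <;> try omega
    · exact absurd (hpadic p) (not_isSoluble_padic_of_nonresidue_of_sq_dvd (p := p) (c := -21 * q) (e' := 56 * q ^ 2) (by ring)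
        (show d' = (p : ℤ) ^ 2 * (56 * q ^ 2) by linarith) hns_2_p hns_56qq_p)
    · exact absurd (hpadic p) (not_isSoluble_padic_of_nonresidue_of_sq_dvd (p := p) (c := -21 * q) (e' := 8 * q ^ 2) (by ring)
        (show d' = (p : ℤ) ^ 2 * (8 * q ^ 2) by linarith) hns_14_p hns_8qq_p)

/-- **`#S(−21qp, 112q²p²) ≤ 2`** on a75+ (sharp). [cite: SilvermanAEC2009, Prop. X.4.9 and Example X.4.10] -/
theorem card_twoIsogenySelmerGroup_oddTwoPrimesTwist_le_two_plusPFiveAlpha (hq8 : q % 8 = 7) (hq7 : jacobiSym q 7 = -1) (hp8 : p % 8 = 5)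
    (hp7 : legendreSym p (-7) = 1) (hα : ¬ ∃ x : ZMod p, x ^ 4 = -7) (hpq : jacobiSym p q = 1) :
    (twoIsogenySelmerGroup (-21 * ((q : ℤ) * p)) (112 * ((q : ℤ) * p) ^ 2)).card ≤ 2 :=
  (Finset.card_le_card (twoIsogenySelmerGroup_oddTwoPrimesTwist_subset_pair_plusPFiveAlpha hq8 hq7 hp8 hp7 hα hpq)).trans Finset.card_le_two

end SelmerSOddPFive

end Summit.BirchSwinnertonDyer.BirchSwinnertonDyer.Theorems.GoldfeldGoodTwists

end
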